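import Literature.Geometry.Riemannian.KernelGradientIntegralBoundAux
import Literature.Geometry.Riemannian.HeatKernelBasePointDerivUnderIntegral
import Literature.Geometry.Riemannian.HeatKernelIndicatorGradientEstimate
import Literature.Probability.Distributions.TailConstraintSecondMoment
import HarnessLib

/-!
# Bamler's sharp `L²` bound for the base-point derivative of the heat kernel
# (Bamler 2020a, Prop. 4.2, case `p = 2`, directional form)

R. Bamler, *Entropy and heat kernel bounds on a Ricci flow background*, arXiv:2008.07093 (2020a),
§4.1, Prop. 4.2 (arXiv v1: Prop. 15), last display: for the conjugate heat kernel measure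
`dν = K(x,t;·,s) dg_s` of a Ricci flow on a compact manifold and any `v ∈ T_xM` with `|v|_t = 1`,

  `(t − s) ∫_M (∂ᵥK(x,t;·,s) / K(x,t;·,s))² dν ≤ 1/2`.

This file PROVES it, following §4.3: for every measurable `X`, the function
`u(x') = ν_{x',t;s}(X)` satisfies `∂ᵥ u = ∫_X q dν` (`q = ∂ᵥK/K`) and, by the improved gradient
estimate Thm. 4.1 for the datum `𝟙_X` (in the tree in Lipschitz form,
`ofReal_abs_PhiInv_heatKernelMeasure_sub_le`), `√(t−s) ∫_X q dν ≤ Φ'(Φ⁻¹(ν(X))) =: F(ν(X))`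
(display (4.7)); the measure-theoretic Claim 4.3 (decreasing rearrangement `h` of `q`,
`∫₀ᵃ h ≤ F(a)`, concavity of `F`) then gives `(t−s)∫ q² dν ≤ ∫₀¹ F'² = ∫₀¹ (Φ⁻¹/2)² = 1/2`
(`integral_sq_le_of_setIntegral_le_concave`, `deriv_Phi_comp_PhiInv_props`). The derivative
`∂ᵥ` is rendered as the derivative at `σ = 0` along an arbitrary `C^∞` curve `γ` with
`g_t(γ̇(0), γ̇(0)) ≤ 1` (so the statement covers every unit or sub-unit tangent vector):

* `IsRicciFlow.mul_integral_sq_deriv_heatKernelFn_div_le` — the bound above;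
* auxiliaries: `hasDerivAt_heatKernelFn_curve`, `measurable_deriv_heatKernelFn_curve`,
  `exists_abs_deriv_heatKernelFn_curve_le` (the directional derivative of `K` along `γ` exists,
  is measurable in `y` and bounded), `heatKernelMeasure_real_eq_setIntegral`,
  `setIntegral_heatKernelMeasure_eq_setIntegral_mul` (`ν`-integrals over sets as
  `K dg_s`-integrals), and the profile `F` (`continuousOn_bamlerProfile`,
  `concaveOn_Icc_bamlerProfile`).

What is NOT here: the case `p ≠ 2` of Prop. 4.2 (`C(n,p)` bounds and the localised bound on
subsets `X`), and the summed form `∫ |∇ₓK|²/K² dν ≤ n/(2(t−s))` over an orthonormal frame.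

## References

* R. H. Bamler, *Entropy and heat kernel bounds on a Ricci flow background*, arXiv:2008.07093
  (2020), §4.1 Prop. 4.2 (arXiv v1 Prop. 15), §4.3 (its proof, Claim 4.3, (4.7)).
  [Bamler2020Entropy]
-/

noncomputable section

open Set Filter Function MeasureTheory Measure
open scoped Manifold ContDiff Topology ENNReal NNReal

namespace Literature.Geometry.Riemannian

open Lorentzian Lorentzian.PseudoRiemannianMetric MetricFlow

/-! ### Bamler's profile `F = Φ' ∘ Φ⁻¹` on `[0, 1]` -/

section Profile

/-- **Bamler's profile `F(a) = Φ'(Φ⁻¹(a))` extended by `0` to `[0,1]` is continuous on `[0,1]`**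
(`F → 0` at `0⁺` and `1⁻`, `deriv_Phi_comp_PhiInv_props`).
[cite: Bamler2020Entropy, §4.3, (4.7)–(4.12)] -/
theorem continuousOn_bamlerProfile :
    ContinuousOn (fun a : ℝ ↦ if a ∈ Ioo (0 : ℝ) 1 then deriv Phi (PhiInv a) else 0)
      (Icc 0 1) := by
  obtain ⟨hder, h0, h1, -, -, -, -⟩ := deriv_Phi_comp_PhiInv_props
  set F : ℝ → ℝ := fun a ↦ if a ∈ Ioo (0 : ℝ) 1 then deriv Phi (PhiInv a) else 0 with hF
  have hFeq : ∀ a ∈ Ioo (0 : ℝ) 1, F a = deriv Phi (PhiInv a) := fun a ha ↦ if_pos ha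
  have hev : ∀ a ∈ Ioo (0 : ℝ) 1, F =ᶠ[𝓝 a] fun a ↦ deriv Phi (PhiInv a) := fun a ha ↦ by
    filter_upwards [Ioo_mem_nhds ha.1 ha.2] with b hb using hFeq b hb
  intro a ha
  rcases eq_or_lt_of_le ha.1 with rfl | ha0
  · -- at `0`
    have hF0 : F 0 = 0 := if_neg (fun h ↦ lt_irrefl _ h.1)
    have hT : Tendsto F (𝓝[>] 0) (𝓝 0) :=
      h0.congr' (by
        filter_upwards [Ioo_mem_nhdsGT (zero_lt_one' ℝ)] with b hb using (hFeq b hb).symm)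
    have hcw : ContinuousWithinAt F (Ioi 0) 0 := by
      rw [ContinuousWithinAt, hF0]; exact hT
    exact (continuousWithinAt_Ioi_iff_Ici.1 hcw).mono Icc_subset_Ici_self
  rcases eq_or_lt_of_le ha.2 with rfl | ha1
  · -- at `1`
    have hF1 : F 1 = 0 := if_neg (fun h ↦ lt_irrefl _ h.2)
    have hT : Tendsto F (𝓝[<] 1) (𝓝 0) :=
      h1.congr' (by
        filter_upwards [Ioo_mem_nhdsLT (zero_lt_one' ℝ)] with b hb using (hFeq b hb).symm)
    have hcw : ContinuousWithinAt F (Iio 1) 1 := by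
      rw [ContinuousWithinAt, hF1]; exact hT
    exact (continuousWithinAt_Iio_iff_Iic.1 hcw).mono Icc_subset_Iic_self
  · -- interior
    have hd := hder a ⟨ha0, ha1⟩
    exact ((hd.continuousAt.congr (hev a ⟨ha0, ha1⟩).symm).continuousWithinAt)

/-- **Bamler's profile is concave on `[0, 1]`** (concave on `(0,1)` by `F'' ≤ 0`,
`deriv_Phi_comp_PhiInv_props`, and continuous on `[0,1]`, so the chord inequality passes to the
endpoints). [cite: Bamler2020Entropy, §4.3, "we obtain F'' ≤ 0"] -/
theorem concaveOn_Icc_bamlerProfile :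
    ConcaveOn ℝ (Icc (0 : ℝ) 1)
      (fun a : ℝ ↦ if a ∈ Ioo (0 : ℝ) 1 then deriv Phi (PhiInv a) else 0) := by
  obtain ⟨-, -, -, hconc, -, -, -⟩ := deriv_Phi_comp_PhiInv_props
  set F : ℝ → ℝ := fun a ↦ if a ∈ Ioo (0 : ℝ) 1 then deriv Phi (PhiInv a) else 0 with hF
  have hFc := continuousOn_bamlerProfile
  have hconc' : ConcaveOn ℝ (Ioo (0 : ℝ) 1) F := by
    refine ⟨convex_Ioo 0 1, fun x hx y hy a b ha hb hab ↦ ?_⟩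
    have hmem : a * x + b * y ∈ Ioo (0 : ℝ) 1 := (convex_Ioo 0 1) hx hy ha hb hab
    have h := hconc.2 hx hy ha hb hab
    simp only [hF, if_pos hx, if_pos hy, if_pos hmem, smul_eq_mul] at h ⊢
    exact h
  -- pass to the closed interval by continuity
  refine ⟨convex_Icc 0 1, fun x hx y hy a b ha hb hab ↦ ?_⟩
  -- approximate `x, y` by interior points `xₙ = (1 - εₙ) x + εₙ/2`, `εₙ → 0⁺`
  have key : ∀ ε ∈ Ioo (0 : ℝ) 1,
      a • F ((1 - ε) * x + ε / 2) + b • F ((1 - ε) * y + ε / 2) ≤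
        F (a • ((1 - ε) * x + ε / 2) + b • ((1 - ε) * y + ε / 2)) := by
    intro ε hε
    have hin : ∀ z ∈ Icc (0 : ℝ) 1, (1 - ε) * z + ε / 2 ∈ Ioo (0 : ℝ) 1 := fun z hz ↦ by
      constructor <;> nlinarith [hz.1, hz.2, hε.1, hε.2]
    exact hconc'.2 (hin x hx) (hin y hy) ha hb hab
  -- the three arguments tend to `x`, `y`, `a x + b y` within `Icc 0 1` as `ε → 0⁺`
  have hlim : ∀ z ∈ Icc (0 : ℝ) 1,
      Tendsto (fun ε : ℝ ↦ (1 - ε) * z + ε / 2) (𝓝[>] 0) (𝓝[Icc 0 1] z) := by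
    intro z hz
    refine tendsto_nhdsWithin_of_tendsto_nhds_of_eventually_within _ ?_ ?_
    · have : Tendsto (fun ε : ℝ ↦ (1 - ε) * z + ε / 2) (𝓝 0) (𝓝 ((1 - 0) * z + 0 / 2)) :=
        ((continuous_const.sub continuous_id).mul continuous_const |>.add
          (continuous_id.div_const 2)).tendsto 0
      simpa using this.mono_left nhdsWithin_le_nhds
    · filter_upwards [Ioo_mem_nhdsGT (zero_lt_one' ℝ)] with ε hε
      exact Ioo_subset_Icc_self (by constructor <;> nlinarith [hz.1, hz.2, hε.1, hε.2])
  have hxy : a • x + b • y ∈ Icc (0 : ℝ) 1 := (convex_Icc 0 1) hx hy ha hb hab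
  have e : ∀ ε : ℝ, a • ((1 - ε) * x + ε / 2) + b • ((1 - ε) * y + ε / 2) =
      (1 - ε) * (a • x + b • y) + ε / 2 := fun ε ↦ by
    simp only [smul_eq_mul]
    have : a * (ε / 2) + b * (ε / 2) = ε / 2 := by rw [← add_mul, hab, one_mul]
    nlinarith [this]
  have hL : Tendsto (fun ε : ℝ ↦ a • F ((1 - ε) * x + ε / 2) + b • F ((1 - ε) * y + ε / 2))
      (𝓝[>] 0) (𝓝 (a • F x + b • F y)) :=
    (((hFc x hx).tendsto.comp (hlim x hx)).const_smul a).add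
      (((hFc y hy).tendsto.comp (hlim y hy)).const_smul b)
  have hR : Tendsto (fun ε : ℝ ↦ F (a • ((1 - ε) * x + ε / 2) + b • ((1 - ε) * y + ε / 2)))
      (𝓝[>] 0) (𝓝 (F (a • x + b • y))) := by
    simp only [e]
    exact (hFc _ hxy).tendsto.comp (hlim _ hxy)
  exact le_of_tendsto_of_tendsto hL hR
    (by filter_upwards [Ioo_mem_nhdsGT (zero_lt_one' ℝ)] with ε hε using key ε hε)

end Profile

/-! ### The directional derivative of the heat kernel along a curve of base points -/

section Kernel

variable {m : ℕ} {H : Type*} [TopologicalSpace H]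
  {I : ModelWithCorners ℝ (EuclideanSpace ℝ (Fin m)) H} [I.Boundaryless]
  {M : Type*} [TopologicalSpace M] [ChartedSpace H M] [IsManifold I ∞ M]
  [T2Space M] [CompactSpace M] [SecondCountableTopology M] [MeasurableSpace M] [BorelSpace M]
  [PreconnectedSpace M]
  {h : ℝ → PseudoRiemannianMetric I ∞ (EuclideanSpace ℝ (Fin m)) (TangentSpace I : M → Type _)}
  {cov : ℝ → CovariantDerivative I (EuclideanSpace ℝ (Fin m)) (TangentSpace I : M → Type _)}
  {a T : ℝ} (hflow : IsRicciFlow h cov (Icc a T)) (hh : IsContMDiffFamilyOn ∞ h univ)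
  (hR : ∀ r, (h r).IsRiemannian)

/-- `σ ↦ K(γ(σ),t;y,s)` is `C^∞` along a `C^∞` curve of base points, for `a < s < t < T`.
[cite: Bamler2020Entropy, §2.3] -/
theorem IsRicciFlow.contDiff_heatKernelFn_curve {s t : ℝ} (has : a < s) (hst : s < t)
    (htT : t < T) {γ : ℝ → M} (hγ : ContMDiff 𝓘(ℝ, ℝ) I ∞ γ) (y : M) :
    ContDiff ℝ ∞ fun σ ↦ hflow.heatKernelFn hh hR t (γ σ) (y, s) := by
  have hs : s ∈ Ioo a T := ⟨has, hst.trans htT⟩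
  have hK := hflow.contMDiffOn_heatKernelFn_basePoint hh hR hs y
  have hι : ContMDiff 𝓘(ℝ, ℝ) (I.prod 𝓘(ℝ, ℝ)) ∞ fun σ : ℝ ↦ (γ σ, t) :=
    hγ.prodMk contMDiff_const
  have hcomp := hK.comp_contMDiff hι fun σ ↦ ⟨mem_univ _, hst, htT⟩
  exact contMDiff_iff_contDiff.1 hcomp

/-- The directional derivative `∂_σ|₀ K(γ(σ),t;y,s)` exists. [cite: Bamler2020Entropy, §4.3] -/
theorem IsRicciFlow.hasDerivAt_heatKernelFn_curve {s t : ℝ} (has : a < s) (hst : s < t)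
    (htT : t < T) {γ : ℝ → M} (hγ : ContMDiff 𝓘(ℝ, ℝ) I ∞ γ) (y : M) (σ₀ : ℝ) :
    HasDerivAt (fun σ ↦ hflow.heatKernelFn hh hR t (γ σ) (y, s))
      (deriv (fun σ ↦ hflow.heatKernelFn hh hR t (γ σ) (y, s)) σ₀) σ₀ :=
  ((hflow.contDiff_heatKernelFn_curve hh hR has hst htT hγ y).differentiable
    (by simp) σ₀).hasDerivAt

/-- **The directional derivative `y ↦ ∂_σ|₀ K(γ(σ),t;y,s)` is measurable** (pointwise limit of
the continuous difference quotients). [folklore] -/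
theorem IsRicciFlow.measurable_deriv_heatKernelFn_curve {s t : ℝ} (has : a < s) (hst : s < t)
    (htT : t < T) {γ : ℝ → M} (hγ : ContMDiff 𝓘(ℝ, ℝ) I ∞ γ) :
    Measurable fun y ↦ deriv (fun σ ↦ hflow.heatKernelFn hh hR t (γ σ) (y, s)) 0 := by
  have ht : t ∈ Ioc a T := ⟨has.trans hst, htT.le⟩
  have hs : s ∈ Ioo a t := ⟨has, hst⟩
  set K : M → M → ℝ := fun x y ↦ hflow.heatKernelFn hh hR t x (y, s) with hK
  -- difference quotients along `σₙ = 1/(n+1)`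
  set f : ℕ → M → ℝ := fun n y ↦
    ((1 : ℝ) / ((n : ℝ) + 1))⁻¹ * (K (γ (1 / ((n : ℝ) + 1))) y - K (γ 0) y) with hf
  have hfm : ∀ n, Measurable (f n) := fun n ↦
    (((hflow.continuous_heatKernelFn_slice hh hR ht _ hs).sub
      (hflow.continuous_heatKernelFn_slice hh hR ht _ hs)).const_mul _).measurable
  refine measurable_of_tendsto_metrizable hfm (tendsto_pi_nhds.2 fun y ↦ ?_)
  have hd := hflow.hasDerivAt_heatKernelFn_curve hh hR has hst htT hγ y 0
  have hsl := hd.tendsto_slope_zero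
  have hseq : Tendsto (fun n : ℕ ↦ (1 : ℝ) / ((n : ℝ) + 1)) atTop (𝓝[≠] 0) :=
    tendsto_nhdsWithin_iff.2 ⟨tendsto_one_div_add_atTop_nhds_zero_nat,
      Eventually.of_forall fun n ↦ mem_compl_singleton_iff.2 (by positivity)⟩
  have := hsl.comp hseq
  refine this.congr fun n ↦ ?_
  simp [hf, hK, smul_eq_mul]

/-- **The directional derivative of the heat kernel is bounded**, uniformly in `y`: `K(·,t;y,s)`
is Lipschitz for `d_{g_t}` uniformly in `y` (`heatKernelFn_lipschitz_basePoint`) and a `C¹`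
curve is Lipschitz for `d_{g_t}` (`exists_edist_le_mul_sub_of_contMDiff`). [folklore] -/
theorem IsRicciFlow.exists_abs_deriv_heatKernelFn_curve_le {s t : ℝ} (has : a < s) (hst : s < t)
    (htT : t < T) {γ : ℝ → M} (hγ : ContMDiff 𝓘(ℝ, ℝ) I ∞ γ) :
    ∃ B : ℝ, ∀ y, |deriv (fun σ ↦ hflow.heatKernelFn hh hR t (γ σ) (y, s)) 0| ≤ B := by
  have ht : t ∈ Ioc a T := ⟨has.trans hst, htT.le⟩
  -- Lipschitz constant of the kernel in the base point on the slab `[a', s]`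
  obtain ⟨a', haa', ha's⟩ : ∃ a', a < a' ∧ a' < s := ⟨(a + s) / 2, by linarith, by linarith⟩
  obtain ⟨L, hL⟩ := hflow.heatKernelFn_lipschitz_basePoint hh hR ht haa' ha's hst
  -- Lipschitz constant of the curve on `[-1, 1]`
  have hγ1 : ContMDiff 𝓘(ℝ, ℝ) I 1 γ := hγ.of_le (by exact_mod_cast le_top)
  obtain ⟨C, hC0, hC⟩ := exists_edist_le_mul_sub_of_contMDiff (h t) (hR t) hγ1 (-1) 1
  -- `|L|` works as well as `L`
  refine ⟨|L| * C, fun y ↦ ?_⟩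
  have hp : (y, s) ∈ (univ : Set M) ×ˢ Icc a' s := ⟨mem_univ _, ha's.le, le_rfl⟩
  have hlip : ∀ᶠ σ in 𝓝 (0 : ℝ), ‖hflow.heatKernelFn hh hR t (γ σ) (y, s) -
      hflow.heatKernelFn hh hR t (γ 0) (y, s)‖ ≤ |L| * C * ‖σ - 0‖ := by
    filter_upwards [Icc_mem_nhds (show (-1 : ℝ) < 0 by norm_num) (show (0 : ℝ) < 1 by norm_num)]
      with σ hσ
    rw [sub_zero, Real.norm_eq_abs, Real.norm_eq_abs]
    -- `d_t(γ σ, γ 0) ≤ C |σ|`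
    have hd : (h t).edist (hR t) (γ σ) (γ 0) ≤ ENNReal.ofReal (C * |σ|) := by
      rcases le_or_gt 0 σ with h0 | h0
      · rw [(h t).edist_comm (hR t), abs_of_nonneg h0]
        simpa using hC (by norm_num : (-1 : ℝ) ≤ 0) h0 hσ.2
      · rw [abs_of_neg h0]
        have := hC hσ.1 h0.le zero_le_one
        simpa using this
    have h1 := hL (γ σ) (γ 0) (y, s) hp
    have h2 : ENNReal.ofReal |hflow.heatKernelFn hh hR t (γ σ) (y, s) -
        hflow.heatKernelFn hh hR t (γ 0) (y, s)| ≤ ENNReal.ofReal (|L| * (C * |σ|)) := by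
      refine h1.trans ?_
      calc ENNReal.ofReal L * (h t).edist (hR t) (γ σ) (γ 0)
          ≤ ENNReal.ofReal |L| * ENNReal.ofReal (C * |σ|) :=
            mul_le_mul' (ENNReal.ofReal_le_ofReal (le_abs_self L)) hd
        _ = ENNReal.ofReal (|L| * (C * |σ|)) := by
            rw [← ENNReal.ofReal_mul (abs_nonneg L)]
    have h3 := (ENNReal.ofReal_le_ofReal_iff (by positivity)).1 h2
    linarith
  have := norm_deriv_le_of_lip' (by positivity) hlip
  simpa [Real.norm_eq_abs] using this

/-- **`ν_{x,t;s}(X) = ∫_X K(x,t;y,s) dg_s(y)`** as a real number.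
[cite: Bamler2020Entropy, §2.3, Def. 2.4] -/
theorem IsRicciFlow.heatKernelMeasure_real_eq_setIntegral {t : ℝ} (ht : t ∈ Ioc a T) (x : M)
    {s : ℝ} (hs : s ∈ Ioo a t) {X : Set M} (hX : MeasurableSet X) :
    (heatKernelMeasure hh hR t x s).real X =
      ∫ y in X, hflow.heatKernelFn hh hR t x (y, s) ∂(h s).riemVolume := by
  haveI : IsFiniteMeasure (h s).riemVolume := ⟨(h s).riemVolume_univ_lt_top⟩
  have hKc : Continuous fun y ↦ hflow.heatKernelFn hh hR t x (y, s) :=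
    hflow.continuous_heatKernelFn_slice hh hR ht x hs
  have hK0 : ∀ y, 0 ≤ hflow.heatKernelFn hh hR t x (y, s) := fun y ↦
    (hflow.heatKernelFn_pos hh hR ht x ⟨mem_univ _, hs⟩).le
  have hint : Integrable (fun y ↦ hflow.heatKernelFn hh hR t x (y, s)) (h s).riemVolume :=
    hKc.integrable_of_hasCompactSupport (HasCompactSupport.of_compactSpace _)
  rw [measureReal_def, hflow.heatKernelMeasure_eq_withDensity_heatKernelFn hh hR ht x hs,
    withDensity_apply _ hX, ← ofReal_integral_eq_lintegral_ofReal hint.integrableOn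
      (ae_of_all _ hK0), ENNReal.toReal_ofReal (setIntegral_nonneg hX fun y _ ↦ hK0 y)]

/-- **Set integrals against `ν_{x,t;s}` are set integrals against `K dg_s`**:
`∫_X φ dν_{x,t;s} = ∫_X φ(y) K(x,t;y,s) dg_s(y)`. [cite: Bamler2020Entropy, §2.3, Def. 2.4] -/
theorem IsRicciFlow.setIntegral_heatKernelMeasure_eq_setIntegral_mul {t : ℝ} (ht : t ∈ Ioc a T)
    (x : M) {s : ℝ} (hs : s ∈ Ioo a t) {X : Set M} (hX : MeasurableSet X) (φ : M → ℝ) :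
    ∫ y in X, φ y ∂(heatKernelMeasure hh hR t x s) =
      ∫ y in X, φ y * hflow.heatKernelFn hh hR t x (y, s) ∂(h s).riemVolume := by
  rw [← integral_indicator hX, ← integral_indicator hX,
    hflow.integral_heatKernelMeasure_eq_integral_mul_heatKernelFn hh hR ht x hs]
  refine integral_congr_ae (Eventually.of_forall fun y ↦ ?_)
  simp only [Set.indicator_mul_left]

end Kernel

/-! ### Prop. 4.2 for `p = 2` -/

section Prop42

variable {m : ℕ} {H : Type*} [TopologicalSpace H]
  {I : ModelWithCorners ℝ (EuclideanSpace ℝ (Fin m)) H} [I.Boundaryless]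
  {M : Type*} [TopologicalSpace M] [ChartedSpace H M] [IsManifold I ∞ M]
  [T2Space M] [CompactSpace M] [SecondCountableTopology M] [MeasurableSpace M] [BorelSpace M]
  [PreconnectedSpace M]
  {h : ℝ → PseudoRiemannianMetric I ∞ (EuclideanSpace ℝ (Fin m)) (TangentSpace I : M → Type _)}
  {cov : ℝ → CovariantDerivative I (EuclideanSpace ℝ (Fin m)) (TangentSpace I : M → Type _)}
  {a T : ℝ} (hflow : IsRicciFlow h cov (Icc a T)) (hh : IsContMDiffFamilyOn ∞ h univ)
  (hR : ∀ r, (h r).IsRiemannian)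

/-- **Bamler's tail constraint (4.7)**: for every Borel `X`,
`√(t−s) ∫_X ∂_σ|₀K(γσ,t;y,s) dg_s(y) ≤ F(ν_{γ 0,t;s}(X))`, `F = Φ'∘Φ⁻¹` extended by `0`
(Thm. 4.1 for the datum `𝟙_X` in Lipschitz form along the curve, then the derivative bound
`abs_deriv_le_of_abs_PhiInv_sub_le`; the degenerate cases `g_s(X) = 0` or `g_s(Xᶜ) = 0` give
`0 ≤ 0`).
[cite: Bamler2020Entropy, §4.3, (4.7)] -/
theorem IsRicciFlow.sqrt_mul_setIntegral_deriv_heatKernelFn_le {s t : ℝ} (has : a < s)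
    (hst : s < t) (htT : t < T) {γ : ℝ → M} (hγ : ContMDiff 𝓘(ℝ, ℝ) I ∞ γ)
    (h1 : (h t).val (γ 0) (velocity I γ 0) (velocity I γ 0) ≤ 1) {X : Set M}
    (hX : MeasurableSet X) :
    Real.sqrt (t - s) * ∫ y in X, deriv (fun σ ↦ hflow.heatKernelFn hh hR t (γ σ) (y, s)) 0
        ∂(h s).riemVolume ≤
      (fun a : ℝ ↦ if a ∈ Ioo (0 : ℝ) 1 then deriv Phi (PhiInv a) else 0)
        ((heatKernelMeasure hh hR t (γ 0) s).real X) := by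
  haveI : IsFiniteMeasure (h s).riemVolume := ⟨(h s).riemVolume_univ_lt_top⟩
  have ht : t ∈ Ioc a T := ⟨has.trans hst, htT.le⟩
  have hs : s ∈ Ioo a t := ⟨has, hst⟩
  have hc : 0 < Real.sqrt (t - s) := Real.sqrt_pos.2 (sub_pos.2 hst)
  set K' : M → ℝ := fun y ↦ deriv (fun σ ↦ hflow.heatKernelFn hh hR t (γ σ) (y, s)) 0 with hK'
  set F : ℝ → ℝ := fun a ↦ if a ∈ Ioo (0 : ℝ) 1 then deriv Phi (PhiInv a) else 0 with hF
  have hF0 : ∀ b, 0 ≤ F b := fun b ↦ by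
    simp only [hF]
    split_ifs
    · exact (deriv_Phi_pos _).le
    · exact le_rfl
  -- `u σ = ν_{γ σ,t;s}(X) = ∫_X K(γσ,t;y,s) dg_s` and its derivative at `0`
  set u : ℝ → ℝ := fun σ ↦ (heatKernelMeasure hh hR t (γ σ) s).real X with hu
  have hueq : ∀ σ, u σ = ∫ y in X, hflow.heatKernelFn hh hR t (γ σ) (y, s) ∂(h s).riemVolume :=
    fun σ ↦ hflow.heatKernelMeasure_real_eq_setIntegral hh hR ht (γ σ) hs hX
  have hD := hasDerivAt_setIntegral_comp_heatKernelFn_curve hflow hh hR has hst htT hγ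
    (Λ := fun k ↦ k) (contDiffOn_id) hX 0
  have hD' : HasDerivAt u (∫ y in X, K' y ∂(h s).riemVolume) 0 := by
    have e1 : (fun σ ↦ ∫ y in X, (fun k : ℝ ↦ k) (hflow.heatKernelFn hh hR t (γ σ) (y, s))
        ∂(h s).riemVolume) = u := by
      funext σ; rw [hueq σ]
    rw [e1] at hD
    refine hD.congr_deriv ?_
    refine integral_congr_ae (Eventually.of_forall fun y ↦ ?_)
    simp [hK']
  -- degenerate cases
  by_cases hXpos : 0 < (h s).riemVolume X
  swap
  · have hX0 : (h s).riemVolume X = 0 := nonpos_iff_eq_zero.1 (not_lt.1 hXpos)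
    have : ∫ y in X, K' y ∂(h s).riemVolume = 0 := by
      rw [Measure.restrict_eq_zero.2 hX0, integral_zero_measure]
    rw [this, mul_zero]
    exact hF0 _
  by_cases hXcpos : 0 < (h s).riemVolume Xᶜ
  swap
  · have hXc0 : (h s).riemVolume Xᶜ = 0 := nonpos_iff_eq_zero.1 (not_lt.1 hXcpos)
    -- `∫_X K' = ∫ K' − ∫_{Xᶜ} K' = d/dσ 1 − 0 = 0`
    obtain ⟨B, hB⟩ := hflow.exists_abs_deriv_heatKernelFn_curve_le hh hR has hst htT hγ
    have hK'm := hflow.measurable_deriv_heatKernelFn_curve hh hR has hst htT hγ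
    have hK'i : Integrable K' (h s).riemVolume :=
      Integrable.of_bound hK'm.aestronglyMeasurable B (ae_of_all _ fun y ↦ by
        rw [Real.norm_eq_abs]; exact hB y)
    have hcompl : ∫ y in Xᶜ, K' y ∂(h s).riemVolume = 0 := by
      rw [Measure.restrict_eq_zero.2 hXc0, integral_zero_measure]
    have hsplit := integral_add_compl hX hK'i
    -- `∫ K' = 0`: derivative of the constant `1`
    have hDuniv := hasDerivAt_setIntegral_comp_heatKernelFn_curve hflow hh hR has hst htT hγ
      (Λ := fun k ↦ k) (contDiffOn_id) MeasurableSet.univ 0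
    have hconst : (fun σ ↦ ∫ y in univ, (fun k : ℝ ↦ k) (hflow.heatKernelFn hh hR t (γ σ) (y, s))
        ∂(h s).riemVolume) = fun _ ↦ (1 : ℝ) := by
      funext σ
      rw [Measure.restrict_univ]
      exact hflow.integral_heatKernelFn_eq_one hh hR ht (γ σ) hs
    rw [hconst] at hDuniv
    have h0 : ∫ y in univ, deriv (fun k : ℝ ↦ k) (hflow.heatKernelFn hh hR t (γ 0) (y, s)) *
        deriv (fun σ ↦ hflow.heatKernelFn hh hR t (γ σ) (y, s)) 0 ∂(h s).riemVolume = 0 :=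
      hDuniv.unique (hasDerivAt_const 0 (1 : ℝ))
    rw [Measure.restrict_univ] at h0
    have h0' : ∫ y, K' y ∂(h s).riemVolume = 0 := by
      rw [← h0]
      refine integral_congr_ae (Eventually.of_forall fun y ↦ ?_)
      simp [hK']
    have : ∫ y in X, K' y ∂(h s).riemVolume = 0 := by linarith
    rw [this, mul_zero]
    exact hF0 _
  -- main case: `0 < ν(X) < 1` for every base point, and the Lipschitz bound of Thm. 4.1
  have hE : ∀ x x' : M, (heatKernelMeasure hh hR t x s).real X ∈ Ioo (0 : ℝ) 1 ∧
      ENNReal.ofReal |PhiInv ((heatKernelMeasure hh hR t x s).real X) -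
          PhiInv ((heatKernelMeasure hh hR t x' s).real X)| ≤
        ENNReal.ofReal (1 / Real.sqrt (t - s)) * (h t).edist (hR t) x x' := fun x x' ↦
    ofReal_abs_PhiInv_heatKernelMeasure_sub_le hflow hh hR has hst htT.le hX hXpos hXcpos x x'
  have hu01 : ∀ σ, u σ ∈ Ioo (0 : ℝ) 1 := fun σ ↦ (hE (γ σ) (γ 0)).1
  -- finiteness of the distance along the curve and the real Lipschitz bound
  have hγ1 : ContMDiff 𝓘(ℝ, ℝ) I 1 γ := hγ.of_le (by exact_mod_cast le_top)
  have hfin : ∀ σ, (h t).edist (hR t) (γ σ) (γ 0) ≠ ⊤ := by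
    intro σ
    obtain ⟨C, -, hC⟩ := exists_edist_le_mul_sub_of_contMDiff (h t) (hR t) hγ1 (min σ 0) (max σ 0)
    rcases le_or_gt σ 0 with h0 | h0
    · exact ne_top_of_le_ne_top ENNReal.ofReal_ne_top (hC (min_le_left _ _) h0 (le_max_right _ _))
    · rw [(h t).edist_comm (hR t)]
      exact ne_top_of_le_ne_top ENNReal.ofReal_ne_top
        (hC (min_le_right _ _) h0.le (le_max_left _ _))
  set ρ : ℝ → ℝ := fun σ ↦ ((h t).edist (hR t) (γ σ) (γ 0)).toReal with hρ
  have hLip : ∀ σ, |PhiInv (u σ) - PhiInv (u 0)| ≤ (1 / Real.sqrt (t - s)) * ρ σ := by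
    intro σ
    have h2 := (hE (γ σ) (γ 0)).2
    rw [← ENNReal.ofReal_toReal (hfin σ), ← ENNReal.ofReal_mul (by positivity)] at h2
    exact (ENNReal.ofReal_le_ofReal_iff (by positivity)).1 h2
  have hρev : ∀ ε : ℝ, 0 < ε → ∀ᶠ σ in 𝓝 (0 : ℝ), ρ σ ≤ (1 + ε) * |σ| := fun ε hε ↦
    (eventually_edist_toReal_le_of_speed_le_one (h t) (hR t) hγ h1 hε).mono fun σ hσ ↦ hσ.2
  have hderiv := abs_deriv_le_of_abs_PhiInv_sub_le hD' hu01 (by positivity) hLip hρev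
  -- conclude
  have hF' : F (u 0) = deriv Phi (PhiInv (u 0)) := if_pos (hu01 0)
  show Real.sqrt (t - s) * ∫ y in X, K' y ∂(h s).riemVolume ≤ F (u 0)
  rw [hF']
  have hle : ∫ y in X, K' y ∂(h s).riemVolume ≤
      1 / Real.sqrt (t - s) * deriv Phi (PhiInv (u 0)) := (le_abs_self _).trans hderiv
  calc Real.sqrt (t - s) * ∫ y in X, K' y ∂(h s).riemVolume
      ≤ Real.sqrt (t - s) * (1 / Real.sqrt (t - s) * deriv Phi (PhiInv (u 0))) :=
        mul_le_mul_of_nonneg_left hle hc.le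
    _ = deriv Phi (PhiInv (u 0)) := by field_simp

/-- **Bamler 2020a, Prop. 4.2, case `p = 2` (directional form).** Let `hflow = (h, cov)` be a
Ricci flow on `[a, T]` of a `C^∞` family of Riemannian metrics on a closed connected manifold
`M` modelled on `ℝᵐ`, `a < s < t < T`, `K = K(x,t;y,s)` its heat kernel and
`ν = ν_{γ(0),t;s} = K(γ 0,t;·,s) dg_s`. For every `C^∞` curve `γ : ℝ → M` with
`g_t(γ̇(0), γ̇(0)) ≤ 1`,

  `(t − s) ∫_M ( ∂_σ|₀ K(γ(σ),t;y,s) / K(γ(0),t;y,s) )² dν(y) ≤ 1/2`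

("if `p = 2` … we even have for any `v ∈ TₓM` with `|v|_t = 1`,
`(t−s)∫ (∂ᵥK/K)² dν ≤ 1/2`"). Proof (§4.3): the tail constraint (4.7)
(`sqrt_mul_setIntegral_deriv_heatKernelFn_le`) for `q = √(t−s) ∂_σK/K`, whose `ν`-mean is
`√(t−s) d/dσ ∫ K dg_s = 0`, and Claim 4.3 with the concave profile `F`, `∫₀¹ F'² = 1/2`
(`integral_sq_le_of_setIntegral_le_concave`, `deriv_Phi_comp_PhiInv_props`).
[cite: Bamler2020Entropy, §4.1, Prop. 4.2 (arXiv v1 Prop. 15), case p = 2] -/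
theorem IsRicciFlow.mul_integral_sq_deriv_heatKernelFn_div_le {s t : ℝ} (has : a < s)
    (hst : s < t) (htT : t < T) {γ : ℝ → M} (hγ : ContMDiff 𝓘(ℝ, ℝ) I ∞ γ)
    (h1 : (h t).val (γ 0) (velocity I γ 0) (velocity I γ 0) ≤ 1) :
    (t - s) * ∫ y, (deriv (fun σ ↦ hflow.heatKernelFn hh hR t (γ σ) (y, s)) 0 /
        hflow.heatKernelFn hh hR t (γ 0) (y, s)) ^ 2 ∂(heatKernelMeasure hh hR t (γ 0) s) ≤
      1 / 2 := by
  haveI : IsFiniteMeasure (h s).riemVolume := ⟨(h s).riemVolume_univ_lt_top⟩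
  have ht : t ∈ Ioc a T := ⟨has.trans hst, htT.le⟩
  have hs : s ∈ Ioo a t := ⟨has, hst⟩
  have hτ : 0 < t - s := sub_pos.2 hst
  set c : ℝ := Real.sqrt (t - s) with hcdef
  have hc : 0 < c := Real.sqrt_pos.2 hτ
  have hc2 : c ^ 2 = t - s := Real.sq_sqrt hτ.le
  set ν : Measure M := heatKernelMeasure hh hR t (γ 0) s with hν
  set K₀ : M → ℝ := fun y ↦ hflow.heatKernelFn hh hR t (γ 0) (y, s) with hK₀
  set K' : M → ℝ := fun y ↦ deriv (fun σ ↦ hflow.heatKernelFn hh hR t (γ σ) (y, s)) 0 with hK'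
  set F : ℝ → ℝ := fun a ↦ if a ∈ Ioo (0 : ℝ) 1 then deriv Phi (PhiInv a) else 0 with hF
  -- positivity / continuity / lower bound of `K₀`
  have hK₀c : Continuous K₀ := hflow.continuous_heatKernelFn_slice hh hR ht (γ 0) hs
  have hK₀pos : ∀ y, 0 < K₀ y := fun y ↦ hflow.heatKernelFn_pos hh hR ht (γ 0) ⟨mem_univ _, hs⟩
  obtain ⟨k₀, hk₀pos, hk₀⟩ : ∃ k₀ : ℝ, 0 < k₀ ∧ ∀ y, k₀ ≤ K₀ y := by
    rcases isEmpty_or_nonempty M with hM | hM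
    · exact ⟨1, one_pos, fun y ↦ (IsEmpty.false y).elim⟩
    · obtain ⟨y₀, -, hy₀⟩ := isCompact_univ.exists_isMinOn univ_nonempty hK₀c.continuousOn
      exact ⟨K₀ y₀, hK₀pos y₀, fun y ↦ hy₀ (mem_univ y)⟩
  -- the normalised score `q = c ∂K/K`
  set q : M → ℝ := fun y ↦ c * (K' y / K₀ y) with hq
  have hK'm : Measurable K' := hflow.measurable_deriv_heatKernelFn_curve hh hR has hst htT hγ
  have hqm : Measurable q := (hK'm.div hK₀c.measurable).const_mul c
  obtain ⟨B, hB⟩ := hflow.exists_abs_deriv_heatKernelFn_curve_le hh hR has hst htT hγ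
  have hB0 : 0 ≤ B := (abs_nonneg _).trans (hB (γ 0))
  have hqbdd : ∃ C : ℝ, ∀ y, |q y| ≤ C := by
    refine ⟨c * (B / k₀), fun y ↦ ?_⟩
    rw [hq, abs_mul, abs_of_pos hc, abs_div, abs_of_pos (hK₀pos y)]
    refine mul_le_mul_of_nonneg_left ?_ hc.le
    exact div_le_div₀ hB0 (hB y) hk₀pos (hk₀ y)
  -- set integrals of `q` against `ν` are `c ∫_X K' dg_s`
  have hqK : ∀ y, K' y / K₀ y * K₀ y = K' y := fun y ↦
    div_mul_cancel₀ _ (hK₀pos y).ne'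
  have hset : ∀ X : Set M, MeasurableSet X →
      ∫ y in X, q y ∂ν = c * ∫ y in X, K' y ∂(h s).riemVolume := by
    intro X hX
    rw [hflow.setIntegral_heatKernelMeasure_eq_setIntegral_mul hh hR ht (γ 0) hs hX]
    rw [← integral_const_mul]
    refine integral_congr_ae (Eventually.of_forall fun y ↦ ?_)
    simp only [hq]
    rw [mul_assoc, hqK y]
  -- mean zero
  have hmean : ∫ y, q y ∂ν = 0 := by
    have := hset univ MeasurableSet.univ
    rw [Measure.restrict_univ, Measure.restrict_univ] at this
    rw [this]
    -- `∫ K' = d/dσ ∫ K(γ σ) dg_s = d/dσ 1 = 0`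
    have hDuniv := hasDerivAt_setIntegral_comp_heatKernelFn_curve hflow hh hR has hst htT hγ
      (Λ := fun k ↦ k) (contDiffOn_id) MeasurableSet.univ 0
    have hconst : (fun σ ↦ ∫ y in univ, (fun k : ℝ ↦ k) (hflow.heatKernelFn hh hR t (γ σ) (y, s))
        ∂(h s).riemVolume) = fun _ ↦ (1 : ℝ) := by
      funext σ
      rw [Measure.restrict_univ]
      exact hflow.integral_heatKernelFn_eq_one hh hR ht (γ σ) hs
    rw [hconst] at hDuniv
    have h0 := hDuniv.unique (hasDerivAt_const 0 (1 : ℝ))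
    rw [Measure.restrict_univ] at h0
    have h0' : ∫ y, K' y ∂(h s).riemVolume = 0 := by
      rw [← h0]
      refine integral_congr_ae (Eventually.of_forall fun y ↦ ?_)
      simp [hK']
    rw [h0', mul_zero]
  -- tail constraint
  have htail : ∀ X : Set M, MeasurableSet X → ∫ y in X, q y ∂ν ≤ F (ν.real X) := by
    intro X hX
    rw [hset X hX]
    exact hflow.sqrt_mul_setIntegral_deriv_heatKernelFn_le hh hR has hst htT hγ h1 hX
  -- the profile
  obtain ⟨hder, -, -, -, -, hFi, hFint⟩ := deriv_Phi_comp_PhiInv_props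
  have hFd : ∀ b ∈ Ioo (0 : ℝ) 1, HasDerivAt F (-(PhiInv b / 2)) b := fun b hb ↦
    (hder b hb).congr_of_eventuallyEq (by
      filter_upwards [Ioo_mem_nhds hb.1 hb.2] with b' hb' using if_pos hb')
  have hF'sq : IntervalIntegrable (fun b ↦ (-(PhiInv b / 2)) ^ 2) volume 0 1 := by
    simpa [neg_sq] using hFi
  haveI : IsProbabilityMeasure ν := by rw [hν]; infer_instance
  have hAB := Literature.Probability.Distributions.integral_sq_le_of_setIntegral_le_concave ν hqm
    hqbdd hmean F (fun b ↦ -(PhiInv b / 2)) continuousOn_bamlerProfile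
    (if_neg (fun h ↦ lt_irrefl _ h.1)) (if_neg (fun h ↦ lt_irrefl _ h.2))
    concaveOn_Icc_bamlerProfile hFd hF'sq htail
  have hhalf : ∫ b in (0 : ℝ)..1, (-(PhiInv b / 2)) ^ 2 = 1 / 2 := by
    simpa [neg_sq] using hFint
  rw [hhalf] at hAB
  -- `∫ q² dν = (t − s) ∫ (K'/K₀)² dν`
  have e : ∫ y, q y ^ 2 ∂ν = (t - s) * ∫ y, (K' y / K₀ y) ^ 2 ∂ν := by
    rw [← integral_const_mul]
    refine integral_congr_ae (Eventually.of_forall fun y ↦ ?_)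
    simp only [hq]
    rw [mul_pow, hc2]
  rw [e] at hAB
  exact hAB

end Prop42

end Literature.Geometry.Riemannian

end
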